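import Summits.QuantumFields.YangMills.Theorems.SwapVirialDeficitSectorLaplaceEndGaussPlugTail
import Summits.QuantumFields.YangMills.Theorems.SwapVirialDeficitSectorLaplaceEndGaussPlugChain
import HarnessLib

/-!
# ★★★ THE PLUG OF `stub_end_gaussCore` (memo-ε), PART 4: `stub_end_gaussCore_of_N2` — the stub of skeleton ➎ v13 VERBATIM from the parametric N2 socket
# (cell ym-idea-1; free-hands support of ⟨stmt-QuantumFields-24197⟩ `SwapVirialDeficit.SwapGluedStiffness`; w3 g67 memo-ε step 6, LEAD g99 memo11 N4)

`stub_end_gaussCore_of_N2 (hN2) : <stub_end_gaussCore of HOME fcl-p3-g48-SectorStiffnessSkeleton.lean>` where `hN2` is the PARAMETRIC socket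
(`∃ CA cA CT pT QT qT K₁ k₁ τw kw, ∀ L τ b ε AF …, ∃ A T, A ≤ ofReal(CA·L^cA·Gauss_{b′}) ∧ T ≤ ofReal(e^{CT·L^pT − bτ^qT/(QT·L^pT)}) ∧ socket`), discharged on the
N2 side by LEAD g99's ✓`endGauss_N2_of_params` ∘ w3 g68's parameter package (P).  Per `(L, τ, b, ε)`: the reference family of ✓`exists_gnoFolHessian`, the socket
instance, ✓`setIntegral_endGaussCore_le_of_socket` (`∫_{G♭} ≤ MAIN + TAIL`); the MAIN half through ✓`gaussCore_of_rate_window` (`lhs := 2κ·cc·π·MAIN`,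
`main := (2π/max b 1)^α·M_ε`, rate ✓`mainPart_rate` + shell floor ✓`mbMain_ge_of_subset` on `[r/2, r]` ⊆ window by ✓`Icc_subset_endShell` ∘ ✓`endShell_subset_bulkWindow`),
the TAIL half by ✓`tailPart_le`; budgets `1/256 + 1/256 = 1/128`; thresholds merged (`K = K₁ + K_R + K_T + 1`, `k = k₁ + k_R + k_T + kw`, `τ₀ = min τ_R τw`).
The skeleton then reads `stub_end_gaussCore := stub_end_gaussCore_of_N2 (endGauss_N2_of_params endGauss_params)`.

HONEST LABEL: bookkeeping toward the plug of `stub_end_gaussCore`; until (P) (w3 g68 ✓`endGauss_params` / LEAD ✓`endGauss_N2_of_params`) and the plug land and the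
skeleton is flipped, `stub_end_gaussCore` is OPEN; `stub_core_tip`, ⟨24197⟩ ∕ ⟨24194⟩ OPEN; item of record ⟨24085⟩ `SubOctaveBounded` aside ∕ untouched; the Yang–Mills
mass gap is NOT proved; no summit is proved by a line.  THEOREMS ONLY (0 `def`, 0 `sorry`), standard axioms, no instances beyond the series' local `ℍ` ones.
Seat ym-line-fcl-p3 g49 (cell ym-idea-1, free hands = ➎ assembler), `--supports stmt-QuantumFields-24197`.  References: [cite: Luscher1983, §2]; [folklore].
-/

set_option autoImplicit false
set_option synthInstance.maxSize 1024

noncomputable section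

open MeasureTheory Quaternion Set Module
open scoped Quaternion BigOperators ENNReal InnerProductSpace
open Literature.MathematicalPhysics.QuantumLattice
open Literature.MathematicalPhysics.QuantumFieldTheory hiding SU2
open Summit.QuantumFields.YangMills.Theorems.SwapTwistDeficit.ToronLog

namespace Summit.QuantumFields.YangMills.Theorems.SwapVirialDeficit.SectorLaplace

open Summit.QuantumFields.YangMills.Theorems.FemtoTransferGap
open Summit.QuantumFields.YangMills.Theorems.FemtoTransferGap.TT
open Summit.QuantumFields.YangMills.Theorems.VirialFluxGap.RingDeficit
open Summit.QuantumFields.YangMills.Theorems.SwapVirialDeficit.SwapRing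
open Summit.QuantumFields.YangMills.Theorems.SwapVirialDeficit.BlowUpRing
open Summit.QuantumFields.YangMills.Theorems.SwapVirialDeficit.Gnomonic (gnomonicWeight normSq3)

variable {L : ℕ} [NeZero L]

/-! ## §3 ★★★ The plug -/

set_option maxHeartbeats 800000 in
/-- ★★★ **THE PLUG (memo-ε): `stub_end_gaussCore` OF SKELETON ➎ v13 VERBATIM FROM THE PARAMETRIC N2 SOCKET `hN2`** (LEAD g99 ✓`endGauss_N2_of_params`
discharges `hN2` modulo w3 g68's parameter package (P)).  Per `(L, τ, b, ε)`: the reference family `AF` of ✓`exists_gnoFolHessian` at `hubAt 0 1`, the socket instance,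
✓`setIntegral_endGaussCore_le_of_socket` (⟹ `∫_{G♭} ≤ MAIN + TAIL`), the main half by ✓`mainPart_rate` ∘ ✓`mbMain_ge_of_subset` (shell `[r/2, r]`, ✓`Icc_subset_endShell`)
through ✓`gaussCore_of_rate_window` (`lhs := 2κ·cc·π·MAIN`, budget `1/256`), the tail half by ✓`tailPart_le` (budget `1/256`); thresholds merged. [cite: Luscher1983, §2] -/
theorem stub_end_gaussCore_of_N2
    (hN2 : ∃ CA : ℝ, 0 < CA ∧ ∃ cA : ℕ, ∃ CT : ℝ, ∃ pT : ℕ, ∃ QT : ℝ, 0 < QT ∧ ∃ qT : ℕ,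
      ∃ K₁ : ℝ, 0 < K₁ ∧ ∃ k₁ : ℕ, ∃ τw : ℝ, 0 < τw ∧ ∃ kw : ℕ,
      ∀ (L : ℕ) [NeZero L] (τ : ℝ), 0 < τ → τ ≤ τw / (L : ℝ) ^ kw → ∀ b : ℝ, K₁ * (L : ℝ) ^ k₁ * τ⁻¹ ^ k₁ ≤ b →
      ∀ ε : GnoSign L, GoodSign ε →
      ∀ AF : GnoCoord L → GnoFol L →ₗ[ℝ] GnoFol L, (∀ η, (AF η).IsSymmetric) →
        (∀ η (y : GnoFol L), ⟪AF η y, y⟫_ℝ =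
          iteratedFDeriv ℝ 2 (fun y' : GnoFol L => gnoDeficit z₀ (fun _ => 1) (hubAt 0 1) ε (η + gnoFolEmb y')) 0 (fun _ => y)) →
        (∀ η (y : GnoFol L), ⟪AF η y, y⟫_ℝ = iteratedFDeriv ℝ 2 (gnoDeficit z₀ (fun _ => 1) (hubAt 0 1) ε) η (fun _ => gnoFolEmb y)) →
        (Measurable fun q : GnoCoord L × GnoFol L => ⟪AF q.1 q.2, q.2⟫_ℝ) →
      ∃ A T : ℝ≥0∞,
        A ≤ ENNReal.ofReal (CA * (L : ℝ) ^ cA *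
          (2 * Real.pi / ((1 - 1 / (2 * (finrank ℝ (GnoFol L) : ℝ))) * b)) ^ ((finrank ℝ (GnoFol L) : ℝ) / 2)) ∧
        T ≤ ENNReal.ofReal (Real.exp (CT * (L : ℝ) ^ pT - b * τ ^ qT / (QT * (L : ℝ) ^ pT))) ∧
        ∀ (u : ℝ × ℝ) (t : Fin 3 → ℝ) (v : Fin 2 → ℝ) (z : Fin 3 → ℝ), t 0 ∈ Ioo (-Real.sqrt τ) (Real.sqrt τ) →
          ∫⁻ F : Fol L → Fin 3 → ℝ,
              ENNReal.ofReal (((1 + (t 0) ^ 2)⁻¹) ^ 2 * gnoDensity ((((![t 1, u.1, u.2] : Fin 3 → ℝ), (![t 2, v 0, v 1] : Fin 3 → ℝ)), (z, F)) : GnoCoord L)) *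
                ({p : ℝ × GnoCoord L | 4 * p.1 ^ 2 / (1 + p.1 ^ 2) ^ 2 < τ ∧ τ ≤ (1 + p.1 ^ 2)⁻¹} \
                      ({p : ℝ × GnoCoord L | 4 * p.1 ^ 2 / (1 + p.1 ^ 2) ^ 2 < τ ∧ τ ≤ (1 + p.1 ^ 2)⁻¹ ∧ |p.1| < τ * Real.sqrt (1 + p.1 ^ 2)} ∩
                        {p : ℝ × GnoCoord L | τ ≤ Real.sqrt (p.2.1.1 1 ^ 2 + p.2.1.1 2 ^ 2)} ∩
                        {p : ℝ × GnoCoord L | |p.2.1.1 0| ≤ 1 * Real.sqrt (1 + p.2.1.1 1 ^ 2 + p.2.1.1 2 ^ 2)}) ∩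
                    {p : ℝ × GnoCoord L | p.2.1.1 1 ^ 2 + p.2.1.1 2 ^ 2 ≤ 1 + p.2.1.1 0 ^ 2}).indicator
                  (fun q : ℝ × GnoCoord L => ENNReal.ofReal (Real.exp (-(b * gnoDeficit z₀ (fun _ => 1) (hubAt q.1 1) ε q.2))))
                  (t 0, ((((![t 1, u.1, u.2] : Fin 3 → ℝ), (![t 2, v 0, v 1] : Fin 3 → ℝ)), (z, F)) : GnoCoord L)) ≤
            (A * ENNReal.ofReal ((Real.sqrt (LinearMap.det (AF (gnoBase (t 1) (t 2)))))⁻¹) + T) *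
              ENNReal.ofReal (((1 + t 1 ^ 2 + (u.1 ^ 2 + u.2 ^ 2)) ^ 2)⁻¹ * Real.exp (-(b / (6 * (55200 * (L : ℝ) ^ 6)) *
                (16 * (t 0) ^ 2 / (1 + (t 0) ^ 2) + 8 * (t 1) ^ 2 / ((1 + (t 1) ^ 2) * (1 + (t 0) ^ 2)) + 4 * (t 2) ^ 2 / (1 + (t 2) ^ 2)) *
                (u.1 ^ 2 + u.2 ^ 2) / (1 + t 1 ^ 2 + (u.1 ^ 2 + u.2 ^ 2))))) *
              ENNReal.ofReal (((1 + t 2 ^ 2 + (v 0 ^ 2 + v 1 ^ 2)) ^ 2)⁻¹ *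
                Real.exp (-(b / (6 * (55200 * (L : ℝ) ^ 6)) * (v 0 ^ 2 + v 1 ^ 2) / (1 + t 2 ^ 2 + (v 0 ^ 2 + v 1 ^ 2))))) *
              ENNReal.ofReal (gnomonicWeight z * Real.exp (-(b / (6 * (55200 * (L : ℝ) ^ 6)) * normSq3 z / (1 + normSq3 z))))) :
    ∃ K : ℝ, 0 < K ∧ ∃ k : ℕ, ∃ τ₀ : ℝ, 0 < τ₀ ∧ τ₀ ≤ 1 / 2 ∧ ∀ (L : ℕ) [NeZero L] (τ : ℝ), 0 < τ → τ ≤ τ₀ / (L : ℝ) ^ k →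
    ∀ b : ℝ, K * (L : ℝ) ^ k * τ⁻¹ ^ k ≤ b → ∀ ε : GnoSign L, GoodSign ε →
      stiffKappa L (1 / 8) * (coneConst * Real.pi *
        ∫ p in {p : ℝ × GnoCoord L | 4 * p.1 ^ 2 / (1 + p.1 ^ 2) ^ 2 < τ ∧ τ ≤ (1 + p.1 ^ 2)⁻¹} \
                ({p : ℝ × GnoCoord L | 4 * p.1 ^ 2 / (1 + p.1 ^ 2) ^ 2 < τ ∧ τ ≤ (1 + p.1 ^ 2)⁻¹ ∧ |p.1| < τ * Real.sqrt (1 + p.1 ^ 2)} ∩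
                  {p : ℝ × GnoCoord L | τ ≤ Real.sqrt (p.2.1.1 1 ^ 2 + p.2.1.1 2 ^ 2)} ∩
                  {p : ℝ × GnoCoord L | |p.2.1.1 0| ≤ 1 * Real.sqrt (1 + p.2.1.1 1 ^ 2 + p.2.1.1 2 ^ 2)}) ∩
              {p : ℝ × GnoCoord L | p.2.1.1 1 ^ 2 + p.2.1.1 2 ^ 2 ≤ 1 + p.2.1.1 0 ^ 2},
            Real.exp (-(b * gnoDeficit z₀ (fun _ => 1) (hubAt p.1 1) ε p.2))
            ∂((volume : Measure (ℝ × GnoCoord L)).withDensity fun p => ENNReal.ofReal (((1 + p.1 ^ 2)⁻¹) ^ 2 * gnoDensity p.2))) ≤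
        (1 / 128 : ℝ) * ((2 * Real.pi / b) ^ alpha L * ∫ a in HubBulk τ, (∫ p : ℝ × ℝ, mbDensity a ε p) ∂coneMeasure) := by
  obtain ⟨CA, hCA, cA, CT, pT, QT, hQT, qT, K₁, hK₁, k₁, τw, hτw, kw, H⟩ := hN2
  -- the tail thresholds
  obtain ⟨KT, hKT, kT, HT⟩ := tailPart_le CT hQT pT qT
  -- the rate bookkeeping for the main part
  set r₀ : ℝ := (2304 * 6 * 122689728 * 36 : ℝ)⁻¹ with hr₀
  have hr₀0 : 0 < r₀ := by rw [hr₀]; positivity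
  set Cm : ℝ := 18 * (Real.pi ^ 4 * (2 * ∫ w : EuclideanSpace ℝ (Fin 3), ((1 + ‖w‖ ^ 2) ^ 2)⁻¹) * 331200 ^ 4) * (CA * (4 / 3)) *
      (900 * Real.exp 1 * ((3 * 44712000 * 2304 * 36) ^ 2) + 1) * ((19 * 20400) ^ 4 * 3 * (8 * 6 * 122689728 * 2304 * 36)) *
      (2 * Real.pi) ^ (-(7 / 2 : ℝ)) with hCm
  have hC3 : 0 ≤ ∫ w : EuclideanSpace ℝ (Fin 3), ((1 + ‖w‖ ^ 2) ^ 2)⁻¹ := integral_nonneg fun w => by positivity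
  -- (if `C₃ = 0` the constant would vanish; add `1` to keep it positive)
  set lhs : ∀ L : ℕ, ℝ → ℝ → GnoSign L → ℝ := fun L τ b ε =>
    if hL : L = 0 then 0 else
      haveI : NeZero L := ⟨hL⟩
      2 * stiffKappa L (1 / 8) * (coneConst * Real.pi *
      ((Real.pi ^ 2 / (b / (6 * (55200 * (L : ℝ) ^ 6))) * (Real.pi ^ 2 / (b / (6 * (55200 * (L : ℝ) ^ 6)))) *
          (2 * (∫ w : EuclideanSpace ℝ (Fin 3), ((1 + ‖w‖ ^ 2) ^ 2)⁻¹) / ((1 + b / (6 * (55200 * (L : ℝ) ^ 6))) * Real.sqrt (1 + b / (6 * (55200 * (L : ℝ) ^ 6)))))) *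
        (CA * (L : ℝ) ^ cA * (2 * Real.pi / ((1 - 1 / (2 * (finrank ℝ (GnoFol L) : ℝ))) * b)) ^ ((finrank ℝ (GnoFol L) : ℝ) / 2) *
          (Real.exp 1 * (900 * (Real.sqrt τ) ^ (1 / 3 : ℝ) *
              (2 * ((2304 * (L : ℝ) ^ 6 * (Fintype.card (Fol L) : ℝ))⁻¹ / (3 * (Fintype.card (Fol L) : ℝ) * 44712000 * (L : ℝ) ^ 4))) ^ (1 / 3 : ℝ) *
              (2 * ((2304 * (L : ℝ) ^ 6 * (Fintype.card (Fol L) : ℝ))⁻¹ / (3 * (Fintype.card (Fol L) : ℝ) * 44712000 * (L : ℝ) ^ 4))) ^ (1 / 3 : ℝ) *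
              ((2 * ((2304 * (L : ℝ) ^ 6 * (Fintype.card (Fol L) : ℝ))⁻¹ / (3 * (Fintype.card (Fol L) : ℝ) * 44712000 * (L : ℝ) ^ 4))) *
                (2 * ((2304 * (L : ℝ) ^ 6 * (Fintype.card (Fol L) : ℝ))⁻¹ / (3 * (Fintype.card (Fol L) : ℝ) * 44712000 * (L : ℝ) ^ 4))))⁻¹) + Real.sqrt τ) *
            ((((1 + (finrank ℝ (GnoFol L) : ℝ)) * (20400 * (L : ℝ) ^ 4)) ^ (7 / 2 : ℝ) * Real.exp (1 / 2 : ℝ) *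
                Real.exp ((3 * (Fintype.card (Fol L) : ℝ)) * (122689728 * ((2304 * (L : ℝ) ^ 6 * (Fintype.card (Fol L) : ℝ))⁻¹ /
                  (6 * (Fintype.card (Fol L) : ℝ) * 122689728 * (L : ℝ) ^ 4)) * (L : ℝ) ^ 4) / (2304 * (L : ℝ) ^ 6 * (Fintype.card (Fol L) : ℝ))⁻¹)) *
              (8 / ((2304 * (L : ℝ) ^ 6 * (Fintype.card (Fol L) : ℝ))⁻¹ / (6 * (Fintype.card (Fol L) : ℝ) * 122689728 * (L : ℝ) ^ 4))) *
              ∫ δ' in Icc ((2304 * (L : ℝ) ^ 6 * (Fintype.card (Fol L) : ℝ))⁻¹ / (6 * (Fintype.card (Fol L) : ℝ) * 122689728 * (L : ℝ) ^ 4) / 2)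
                ((2304 * (L : ℝ) ^ 6 * (Fintype.card (Fol L) : ℝ))⁻¹ / (6 * (Fintype.card (Fol L) : ℝ) * 122689728 * (L : ℝ) ^ 4)),
                ((1 + δ' ^ 2)⁻¹) ^ 2 * ∫ p : ℝ × ℝ, mbDensity (L := L) (hubAt δ' 1) ε p)))) with hlhs
  set main : ∀ L : ℕ, ℝ → ℝ → GnoSign L → ℝ := fun L τ b ε =>
    if hL : L = 0 then 0 else
      haveI : NeZero L := ⟨hL⟩
      (2 * Real.pi / max b 1) ^ alpha L * ∫ a in HubBulk τ, (∫ p : ℝ × ℝ, mbDensity (L := L) a ε p) ∂coneMeasure with hmain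
  have hmain0 : ∀ (L : ℕ) (τ b : ℝ) (ε : GnoSign L), 0 ≤ main L τ b ε := by
    intro L τ b ε
    rw [hmain]
    simp only
    split_ifs with hL
    · exact le_rfl
    · haveI : NeZero L := ⟨hL⟩
      exact mul_nonneg (Real.rpow_nonneg (div_nonneg (by positivity) (le_trans zero_le_one (le_max_right _ _))) _)
        (setIntegral_nonneg (measurableSet_hubBulk τ) fun a _ => integral_nonneg fun p => mbDensity_nonneg a ε p)
  have hCm0 : 0 < Cm + 1 := by
    have : 0 ≤ Cm := by rw [hCm]; positivity
    linarith
  have hrate : ∀ (L : ℕ) [NeZero L] (τ : ℝ), 0 < τ → τ ≤ min (1 / 2) (r₀ ^ 2 / 4) / (L : ℝ) ^ 36 →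
      ∀ b : ℝ, 1 * (L : ℝ) ^ 0 * τ⁻¹ ^ 0 ≤ b → ∀ ε : GnoSign L, GoodSign ε →
        lhs L τ b ε ≤ (Cm + 1) * (L : ℝ) ^ (114 + cA) * τ ^ (1 / 6 : ℝ) * main L τ b ε := by
    intro L _ τ hτ hτle b hb ε hε
    have hL1 : (1 : ℝ) ≤ L := by exact_mod_cast NeZero.one_le
    have hL0 : (0 : ℝ) < L := by linarith
    have hb1 : 1 ≤ b := by simpa using hb
    have hb0 : 0 < b := by linarith
    have hL36 : (1 : ℝ) ≤ (L : ℝ) ^ 36 := one_le_pow₀ hL1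
    have hτmin : τ ≤ min (1 / 2) (r₀ ^ 2 / 4) := hτle.trans (div_le_self (le_min (by norm_num) (by positivity)) hL36)
    have hτ2 : τ ≤ 1 / 2 := hτmin.trans (min_le_left _ _)
    have hτ1 : τ ≤ 1 := by linarith
    -- the shell radius
    obtain ⟨hr0, hr1, -, -, -, hrlow⟩ := shellRadius_facts (L := L)
    set r : ℝ := (2304 * (L : ℝ) ^ 6 * (Fintype.card (Fol L) : ℝ))⁻¹ / (6 * (Fintype.card (Fol L) : ℝ) * 122689728 * (L : ℝ) ^ 4) with hr
    have hτr : τ ≤ r ^ 2 / 4 := by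
      have h1 : τ ≤ r₀ ^ 2 / 4 / (L : ℝ) ^ 36 := hτle.trans (div_le_div_of_nonneg_right (min_le_right _ _) (by positivity))
      have h2 : r₀ / (L : ℝ) ^ 18 ≤ r := by rw [hr₀]; exact hrlow
      have h3 : 0 ≤ r₀ / (L : ℝ) ^ 18 := by positivity
      have h4 : (r₀ / (L : ℝ) ^ 18) ^ 2 ≤ r ^ 2 := pow_le_pow_left₀ h3 h2 2
      have e : r₀ ^ 2 / 4 / (L : ℝ) ^ 36 = (r₀ / (L : ℝ) ^ 18) ^ 2 / 4 := by field_simp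
      rw [e] at h1
      linarith
    have hS : Icc (r / 2) r ⊆ {δ : ℝ | τ ≤ 4 * δ ^ 2 / (1 + δ ^ 2) ^ 2 ∧ τ ≤ (1 + δ ^ 2)⁻¹} :=
      (Icc_subset_endShell hr0 hr1 hτr).trans (endShell_subset_bulkWindow hτ2 hr1)
    have hshell := mbMain_ge_of_subset (L := L) hε hτ hτ1 hS
    have hkey := mainPart_rate (L := L) hCA.le cA hτ hτ1 hb0 ε
    have hG0 : 0 ≤ (2 * Real.pi / b) ^ alpha L := Real.rpow_nonneg (by positivity) _
    have hpre0 : 0 ≤ Cm * (L : ℝ) ^ (114 + cA) * τ ^ (1 / 6 : ℝ) := by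
      have : 0 ≤ Cm := by rw [hCm]; positivity
      exact mul_nonneg (mul_nonneg this (by positivity)) (Real.rpow_nonneg hτ.le _)
    have hmaineq : main L τ b ε = (2 * Real.pi / max b 1) ^ alpha L * ∫ a in HubBulk τ, (∫ p : ℝ × ℝ, mbDensity (L := L) a ε p) ∂coneMeasure :=
      dif_neg (NeZero.ne L)
    have hlhseq : lhs L τ b ε = 2 * stiffKappa L (1 / 8) * (coneConst * Real.pi *
      ((Real.pi ^ 2 / (b / (6 * (55200 * (L : ℝ) ^ 6))) * (Real.pi ^ 2 / (b / (6 * (55200 * (L : ℝ) ^ 6)))) *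
          (2 * (∫ w : EuclideanSpace ℝ (Fin 3), ((1 + ‖w‖ ^ 2) ^ 2)⁻¹) / ((1 + b / (6 * (55200 * (L : ℝ) ^ 6))) * Real.sqrt (1 + b / (6 * (55200 * (L : ℝ) ^ 6)))))) *
        (CA * (L : ℝ) ^ cA * (2 * Real.pi / ((1 - 1 / (2 * (finrank ℝ (GnoFol L) : ℝ))) * b)) ^ ((finrank ℝ (GnoFol L) : ℝ) / 2) *
          (Real.exp 1 * (900 * (Real.sqrt τ) ^ (1 / 3 : ℝ) *
              (2 * ((2304 * (L : ℝ) ^ 6 * (Fintype.card (Fol L) : ℝ))⁻¹ / (3 * (Fintype.card (Fol L) : ℝ) * 44712000 * (L : ℝ) ^ 4))) ^ (1 / 3 : ℝ) *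
              (2 * ((2304 * (L : ℝ) ^ 6 * (Fintype.card (Fol L) : ℝ))⁻¹ / (3 * (Fintype.card (Fol L) : ℝ) * 44712000 * (L : ℝ) ^ 4))) ^ (1 / 3 : ℝ) *
              ((2 * ((2304 * (L : ℝ) ^ 6 * (Fintype.card (Fol L) : ℝ))⁻¹ / (3 * (Fintype.card (Fol L) : ℝ) * 44712000 * (L : ℝ) ^ 4))) *
                (2 * ((2304 * (L : ℝ) ^ 6 * (Fintype.card (Fol L) : ℝ))⁻¹ / (3 * (Fintype.card (Fol L) : ℝ) * 44712000 * (L : ℝ) ^ 4))))⁻¹) + Real.sqrt τ) *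
            ((((1 + (finrank ℝ (GnoFol L) : ℝ)) * (20400 * (L : ℝ) ^ 4)) ^ (7 / 2 : ℝ) * Real.exp (1 / 2 : ℝ) *
                Real.exp ((3 * (Fintype.card (Fol L) : ℝ)) * (122689728 * ((2304 * (L : ℝ) ^ 6 * (Fintype.card (Fol L) : ℝ))⁻¹ /
                  (6 * (Fintype.card (Fol L) : ℝ) * 122689728 * (L : ℝ) ^ 4)) * (L : ℝ) ^ 4) / (2304 * (L : ℝ) ^ 6 * (Fintype.card (Fol L) : ℝ))⁻¹)) *
              (8 / ((2304 * (L : ℝ) ^ 6 * (Fintype.card (Fol L) : ℝ))⁻¹ / (6 * (Fintype.card (Fol L) : ℝ) * 122689728 * (L : ℝ) ^ 4))) *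
              ∫ δ' in Icc ((2304 * (L : ℝ) ^ 6 * (Fintype.card (Fol L) : ℝ))⁻¹ / (6 * (Fintype.card (Fol L) : ℝ) * 122689728 * (L : ℝ) ^ 4) / 2)
                ((2304 * (L : ℝ) ^ 6 * (Fintype.card (Fol L) : ℝ))⁻¹ / (6 * (Fintype.card (Fol L) : ℝ) * 122689728 * (L : ℝ) ^ 4)),
                ((1 + δ' ^ 2)⁻¹) ^ 2 * ∫ p : ℝ × ℝ, mbDensity (L := L) (hubAt δ' 1) ε p)))) := dif_neg (NeZero.ne L)
    rw [hlhseq, hmaineq, max_eq_left hb1]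
    have hM0 : 0 ≤ ∫ a in HubBulk τ, (∫ p : ℝ × ℝ, mbDensity (L := L) a ε p) ∂coneMeasure :=
      setIntegral_nonneg (measurableSet_hubBulk τ) fun a _ => integral_nonneg fun p => mbDensity_nonneg a ε p
    calc _ ≤ Cm * (L : ℝ) ^ (114 + cA) * τ ^ (1 / 6 : ℝ) * ((2 * Real.pi / b) ^ alpha L * (coneConst * Real.pi *
          ∫ δ' in Icc (r / 2) r, ((1 + δ' ^ 2)⁻¹) ^ 2 * ∫ p : ℝ × ℝ, mbDensity (L := L) (hubAt δ' 1) ε p)) := hkey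
      _ ≤ Cm * (L : ℝ) ^ (114 + cA) * τ ^ (1 / 6 : ℝ) * ((2 * Real.pi / b) ^ alpha L * ∫ a in HubBulk τ, (∫ p : ℝ × ℝ, mbDensity (L := L) a ε p) ∂coneMeasure) :=
          mul_le_mul_of_nonneg_left (mul_le_mul_of_nonneg_left hshell hG0) hpre0
      _ ≤ (Cm + 1) * (L : ℝ) ^ (114 + cA) * τ ^ (1 / 6 : ℝ) * ((2 * Real.pi / b) ^ alpha L * ∫ a in HubBulk τ, (∫ p : ℝ × ℝ, mbDensity (L := L) a ε p) ∂coneMeasure) := by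
          have h0 : 0 ≤ (L : ℝ) ^ (114 + cA) * τ ^ (1 / 6 : ℝ) * ((2 * Real.pi / b) ^ alpha L * ∫ a in HubBulk τ, (∫ p : ℝ × ℝ, mbDensity (L := L) a ε p) ∂coneMeasure) :=
            mul_nonneg (mul_nonneg (by positivity) (Real.rpow_nonneg hτ.le _)) (mul_nonneg hG0 hM0)
          nlinarith
  obtain ⟨KR, hKR, kR, τR, hτR, hτR2, HR⟩ := gaussCore_of_rate_window lhs main hmain0 (c := 114 + cA) (k₁ := 0) (kw := 36) hCm0
    (by norm_num : (0 : ℝ) < 1 / 6) one_pos (lt_min (by norm_num) (by positivity)) hrate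
  -- the merged thresholds
  have hKsum : 0 < K₁ + KR + KT + 1 := by linarith
  refine ⟨K₁ + KR + KT + 1, hKsum, k₁ + kR + kT + kw, min τR τw, lt_min hτR hτw, (min_le_left _ _).trans hτR2, fun L _ τ hτ hτle b hb ε hε => ?_⟩
  have hL1 : (1 : ℝ) ≤ L := by exact_mod_cast NeZero.one_le
  have hL0 : (0 : ℝ) < L := by linarith
  set k : ℕ := k₁ + kR + kT + kw with hk
  have hLk : (1 : ℝ) ≤ (L : ℝ) ^ k := one_le_pow₀ hL1
  have hτ2 : τ ≤ 1 / 2 := hτle.trans ((div_le_self (lt_min hτR hτw).le hLk).trans ((min_le_left _ _).trans hτR2))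
  have hτ1 : τ ≤ 1 := by linarith
  have hτi1 : 1 ≤ τ⁻¹ := by rw [one_le_inv₀ hτ]; exact hτ1
  have hτR' : τ ≤ τR / (L : ℝ) ^ kR :=
    hτle.trans (div_le_div₀ hτR.le (min_le_left _ _) (by positivity) (pow_le_pow_right₀ hL1 (by omega)))
  have hτw' : τ ≤ τw / (L : ℝ) ^ kw :=
    hτle.trans (div_le_div₀ hτw.le (min_le_right _ _) (by positivity) (pow_le_pow_right₀ hL1 (by omega)))
  have hmono : ∀ {K' : ℝ} {k' : ℕ}, 0 < K' → K' ≤ K₁ + KR + KT + 1 → k' ≤ k → K' * (L : ℝ) ^ k' * τ⁻¹ ^ k' ≤ b := by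
    intro K' k' hK' hK'le hk'
    have h1 : τ⁻¹ ^ k' ≤ τ⁻¹ ^ k := pow_le_pow_right₀ hτi1 hk'
    have h3 : (L : ℝ) ^ k' ≤ (L : ℝ) ^ k := pow_le_pow_right₀ hL1 hk'
    calc K' * (L : ℝ) ^ k' * τ⁻¹ ^ k' ≤ (K₁ + KR + KT + 1) * (L : ℝ) ^ k * τ⁻¹ ^ k :=
          mul_le_mul (mul_le_mul hK'le h3 (by positivity) hKsum.le) h1 (by positivity) (mul_nonneg hKsum.le (by positivity))
      _ ≤ b := hb
  have hb₁ : K₁ * (L : ℝ) ^ k₁ * τ⁻¹ ^ k₁ ≤ b := hmono hK₁ (by linarith) (by omega)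
  have hbR : KR * (L : ℝ) ^ kR * τ⁻¹ ^ kR ≤ b := hmono hKR (by linarith) (by omega)
  have hbT : KT * (L : ℝ) ^ kT * τ⁻¹ ^ kT ≤ b := hmono hKT (by linarith) (by omega)
  have hb1 : 1 ≤ b := by have h := hmono one_pos (by linarith) (Nat.zero_le k); simpa using h
  have hb0 : 0 < b := by linarith
  -- the reference family (I1) and the socket instance
  obtain ⟨AF, hFs, -, hFyy, -, hamb, hAm, -⟩ := exists_gnoFolHessian z₀ (fun _ => (1 : SU2)) (hubAt_one_ne_zero 0) ε (L := L)
  obtain ⟨A, T, hA, hT, hsock⟩ := H L τ hτ hτw' b hb₁ ε hε AF hFs hFyy hamb hAm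
  -- the per-point chain
  obtain ⟨hr0, hr1, hr, -, -, -⟩ := shellRadius_facts (L := L)
  have hq : 0 < 1 - 1 / (2 * (finrank ℝ (GnoFol L) : ℝ)) := by
    have hd2 : (2 : ℝ) ≤ (finrank ℝ (GnoFol L) : ℝ) := by linarith [nine_le_finrank_gnoFol (L := L)]
    have : 1 / (2 * (finrank ℝ (GnoFol L) : ℝ)) ≤ 1 / 4 := by rw [div_le_div_iff₀ (by positivity) (by norm_num)]; linarith
    linarith
  have ha0 : 0 ≤ CA * (L : ℝ) ^ cA * (2 * Real.pi / ((1 - 1 / (2 * (finrank ℝ (GnoFol L) : ℝ))) * b)) ^ ((finrank ℝ (GnoFol L) : ℝ) / 2) :=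
    mul_nonneg (by positivity) (Real.rpow_nonneg (by positivity) _)
  have hchain := setIntegral_endGaussCore_le_of_socket (L := L) hε hτ hτ1 hb0 hFs hFyy hamb hAm hr0 hr1 hr ha0 (Real.exp_pos _).le hA hT hsock
  -- the two halves
  have hmainR := HR L τ hτ hτR' b hbR ε hε
  have hmaineq : main L τ b ε = (2 * Real.pi / max b 1) ^ alpha L * ∫ a in HubBulk τ, (∫ p : ℝ × ℝ, mbDensity (L := L) a ε p) ∂coneMeasure :=
    dif_neg (NeZero.ne L)
  have hlhseq : lhs L τ b ε = 2 * stiffKappa L (1 / 8) * (coneConst * Real.pi *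
      ((Real.pi ^ 2 / (b / (6 * (55200 * (L : ℝ) ^ 6))) * (Real.pi ^ 2 / (b / (6 * (55200 * (L : ℝ) ^ 6)))) *
          (2 * (∫ w : EuclideanSpace ℝ (Fin 3), ((1 + ‖w‖ ^ 2) ^ 2)⁻¹) / ((1 + b / (6 * (55200 * (L : ℝ) ^ 6))) * Real.sqrt (1 + b / (6 * (55200 * (L : ℝ) ^ 6)))))) *
        (CA * (L : ℝ) ^ cA * (2 * Real.pi / ((1 - 1 / (2 * (finrank ℝ (GnoFol L) : ℝ))) * b)) ^ ((finrank ℝ (GnoFol L) : ℝ) / 2) *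
          (Real.exp 1 * (900 * (Real.sqrt τ) ^ (1 / 3 : ℝ) *
              (2 * ((2304 * (L : ℝ) ^ 6 * (Fintype.card (Fol L) : ℝ))⁻¹ / (3 * (Fintype.card (Fol L) : ℝ) * 44712000 * (L : ℝ) ^ 4))) ^ (1 / 3 : ℝ) *
              (2 * ((2304 * (L : ℝ) ^ 6 * (Fintype.card (Fol L) : ℝ))⁻¹ / (3 * (Fintype.card (Fol L) : ℝ) * 44712000 * (L : ℝ) ^ 4))) ^ (1 / 3 : ℝ) *
              ((2 * ((2304 * (L : ℝ) ^ 6 * (Fintype.card (Fol L) : ℝ))⁻¹ / (3 * (Fintype.card (Fol L) : ℝ) * 44712000 * (L : ℝ) ^ 4))) *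
                (2 * ((2304 * (L : ℝ) ^ 6 * (Fintype.card (Fol L) : ℝ))⁻¹ / (3 * (Fintype.card (Fol L) : ℝ) * 44712000 * (L : ℝ) ^ 4))))⁻¹) + Real.sqrt τ) *
            ((((1 + (finrank ℝ (GnoFol L) : ℝ)) * (20400 * (L : ℝ) ^ 4)) ^ (7 / 2 : ℝ) * Real.exp (1 / 2 : ℝ) *
                Real.exp ((3 * (Fintype.card (Fol L) : ℝ)) * (122689728 * ((2304 * (L : ℝ) ^ 6 * (Fintype.card (Fol L) : ℝ))⁻¹ /
                  (6 * (Fintype.card (Fol L) : ℝ) * 122689728 * (L : ℝ) ^ 4)) * (L : ℝ) ^ 4) / (2304 * (L : ℝ) ^ 6 * (Fintype.card (Fol L) : ℝ))⁻¹)) *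
              (8 / ((2304 * (L : ℝ) ^ 6 * (Fintype.card (Fol L) : ℝ))⁻¹ / (6 * (Fintype.card (Fol L) : ℝ) * 122689728 * (L : ℝ) ^ 4))) *
              ∫ δ' in Icc ((2304 * (L : ℝ) ^ 6 * (Fintype.card (Fol L) : ℝ))⁻¹ / (6 * (Fintype.card (Fol L) : ℝ) * 122689728 * (L : ℝ) ^ 4) / 2)
                ((2304 * (L : ℝ) ^ 6 * (Fintype.card (Fol L) : ℝ))⁻¹ / (6 * (Fintype.card (Fol L) : ℝ) * 122689728 * (L : ℝ) ^ 4)),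
                ((1 + δ' ^ 2)⁻¹) ^ 2 * ∫ p : ℝ × ℝ, mbDensity (L := L) (hubAt δ' 1) ε p)))) := dif_neg (NeZero.ne L)
  rw [hlhseq, hmaineq, max_eq_left hb1] at hmainR
  have htail := HT L ε hε τ hτ hτ2 b hbT
  -- conclude
  have hκ0 : 0 ≤ stiffKappa L (1 / 8) := by unfold stiffKappa; nlinarith [one_le_pow₀ (n := 4) hL1]
  have hcc : 0 < coneConst * Real.pi := mul_pos coneConst_pos Real.pi_pos
  have hstep := mul_le_mul_of_nonneg_left (mul_le_mul_of_nonneg_left hchain hcc.le) hκ0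
  refine hstep.trans ?_
  rw [mul_add, mul_add, mul_add]
  have hsum : (1 / 256 : ℝ) * ((2 * Real.pi / b) ^ alpha L * ∫ a in HubBulk τ, (∫ p : ℝ × ℝ, mbDensity (L := L) a ε p) ∂coneMeasure) +
      (1 / 256 : ℝ) * ((2 * Real.pi / b) ^ alpha L * ∫ a in HubBulk τ, (∫ p : ℝ × ℝ, mbDensity (L := L) a ε p) ∂coneMeasure) =
      (1 / 128 : ℝ) * ((2 * Real.pi / b) ^ alpha L * ∫ a in HubBulk τ, (∫ p : ℝ × ℝ, mbDensity (L := L) a ε p) ∂coneMeasure) := by ring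
  rw [← hsum]
  refine add_le_add ?_ htail
  linarith


end Summit.QuantumFields.YangMills.Theorems.SwapVirialDeficit.SectorLaplace

end
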